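import Summits.MatrixMultiplication.MatrixMultiplication.Theorems.SoloInformedTranslationSchemes
import HarnessLib

/-!
# The multiplier group must be polynomially large (Theorem B″, scheme form, one line)

Solo-informed seat (MatrixMultiplication), gen 101; sharpest-statement §2y(8), COROLLARY.
`translationScheme_rank_mul_card_ge_behrend`: for every `m ≥ 1` there is `δ = δ(m) ∈ (0, 1/2]` such
that if the translation scheme `𝒮(S, M₀)` — `S` finite abelian with `g^m = 1`, `M₀ ≤ Aut S` any
subgroup, classes labelled by `c : S → C` — realizes `⟨3N,3N,3N⟩` in the sense of Cohn–Umans 2013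
Def. 12 (injectivity not needed), then
`N² e^{-4√(log N)} ≤ 3 · (|C| · |M₀|)^{1-δ}`.
Since the rank of `𝒮(S, M₀)` is the number of classes (`≤ |C|` for any labelling type `C`; `= |C|` for
a bijective labelling), Conj. 21's requirement rank `≤ n^{2+o(1)}` (`n = 3N`) forces
`|M₀| ≥ n^{2δ/(1-δ) - o(1)}`: along translation schemes over abelian hosts of bounded exponent the
multiplier group must be POLYNOMIALLY LARGE in `n` (equivalently in `|S|`). Plain abelian groups
(`M₀ = 1`), cyclotomic/scalar twists of sub-polynomial size, and every bounded `M₀` are excluded.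
References: CohnUmans2013 (arXiv:1207.6528) §5, Conj. 21; BCCGNSU17 (arXiv:1605.06702).
-/

noncomputable section

open scoped BigOperators
open Finset

namespace Summit.MatrixMultiplication.MatrixMultiplication.Theorems.TwistedSliceRank

section Multiplier

/-- **Rank × |multiplier group| is polynomially larger than `n²`** for translation schemes over
abelian groups of bounded exponent realizing `⟨n,n,n⟩`. [this work] -/
theorem translationScheme_rank_mul_card_ge_behrend (m : ℕ) (hm : 0 < m) :
    ∃ δ : ℝ, 0 < δ ∧ δ ≤ 1 / 2 ∧ ∀ (S : Type) [CommGroup S] [Fintype S] [DecidableEq S],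
      (∀ g : S, g ^ m = 1) →
      ∀ (M₀ : Subgroup (MulAut S)) [Fintype M₀] (C : Type) [Fintype C] [DecidableEq C] (c : S → C),
      (∀ g h : S, c g = c h ↔ ∃ φ : M₀, (φ : MulAut S) g = h) →
      ∀ (N : ℕ) (A B Γ : Fin (3 * N) × Fin (3 * N) → C),
      (∀ x y z : Fin (3 * N) × Fin (3 * N),
          (∃ g h l : S, c g = A x ∧ c h = B y ∧ c l = Γ z ∧ g * h * l = 1) ↔
          (y.1 = x.2 ∧ z = (y.2, x.1))) →
      ((N : ℝ) ^ 2 * Real.exp (-4 * Real.sqrt (Real.log N))) ≤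
        3 * ((Fintype.card C : ℝ) * Fintype.card M₀) ^ (1 - δ) := by
  obtain ⟨δ₀, hδ₀, hmain⟩ := translationScheme_realization_card_ge_behrend m hm
  refine ⟨min δ₀ (1 / 2), lt_min hδ₀ (by norm_num), min_le_right _ _,
    fun S _ _ _ hexpS M₀ _ C _ _ c hc N A B Γ hreal => ?_⟩
  have h1 := hmain S hexpS M₀ C c hc N A B Γ hreal
  have hS1 : (1 : ℝ) ≤ Fintype.card S := by exact_mod_cast Fintype.card_pos
  have hSC : (Fintype.card S : ℝ) ≤ (Fintype.card C : ℝ) * Fintype.card M₀ := by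
    exact_mod_cast card_le_card_labels_mul M₀ c hc
  have h2 : (Fintype.card S : ℝ) ^ (1 - δ₀) ≤ (Fintype.card S : ℝ) ^ (1 - min δ₀ (1 / 2)) :=
    Real.rpow_le_rpow_of_exponent_le hS1 (by linarith [min_le_left δ₀ (1 / 2)])
  have h3 : (Fintype.card S : ℝ) ^ (1 - min δ₀ (1 / 2)) ≤
      ((Fintype.card C : ℝ) * Fintype.card M₀) ^ (1 - min δ₀ (1 / 2)) :=
    Real.rpow_le_rpow (by positivity) hSC (by linarith [min_le_right δ₀ (1 / 2)])
  linarith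

end Multiplier

end Summit.MatrixMultiplication.MatrixMultiplication.Theorems.TwistedSliceRank
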